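import Literature.MathematicalPhysics.QuantumFieldTheory.Balaban1983to89.Node00.Record13NumericsOfThm1CCMZ
import Summits.QuantumFields.YangMills.Theorems.BalabanUVNodesN11SupplyChainAtCRLetteredNumerics

/-!
# DAG node N11 — THE cR-LETTERED MEMBER AT DEF-1's Z FAMILY: `θ₁₃ᶻ(n_c, ε₂₉; Efl, logz) = theta13LiveOfNumericsZ F N n_c ε₂₉ ζ Rz Zt Efl logz`,
# `n_c := {θ₁₅ᶜᶜᴹᵂ(j; γ)'s numerics with s2.cR := c}` — the `c := 1` z-member IS the z-witness `theta13OfThm1CCMWZ … Efl logz` (`rfl`), the c-BLIND rows, and the θ-level letters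
# (`2 ≤ cR`, nesting, the five numeric rows) at every H-extension — this seat's g4 p619867 §1∕§1b∕§2 RE-ISSUED BY TOKEN-PASS (№218 (3))

HEADER — WORK-UNIT METADATA.  Cell `pub-ymgap`, YM-PLAN Track A (HUMAN RULING D-0062 ∕ D-0149 width seats), seat `pub-ymgap-dag-n11-w3` (g5; WIDTH SEAT 3∕4 on NODE n11 [B14]),
route `BalabanUVNodes` rev 29, item K1⁹ `StabilityBRunRowsAtRecordR13SepCoPHV` = stmt-QuantumFields-27364 (helper lane `--kind proof --supports 27364 --as helper`, count-neutral) ·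
FLAG №9 z-witness re-key (director-ym №218 (3): «consumers re-key by token-pass, one declarer per OWN file»).  [III] = [Balaban1988Convergent], [15] = [Balaban1985Variational],
[I] = [Balaban1987RG1], [IV] = [Balaban1989LargeFieldI], [B7] = [Balaban1985Averaging].  Over DEF-1 g9's Z2 `Node00/Record13NumericsOfThm1CCMZ` (p639492:
`theta13LiveOfNumericsZ`, `theta13OfThm1CCMWZ … Efl logz := theta13LiveOfNumericsZ F N (stage12NumericsOfThm1CCMW …) … Efl logz`, `theta13LiveOfNumerics_eq_Z` `rfl` at
`(Efl, logz) = (0, 0)`) and this seat's g4 p619867 `…SupplyChainAtCRLetteredNumerics` (whose θ-FREE term views `ccmwCR_s2_cR ∕ _ν ∕ _γ ∕ _τ9 ∕ _s2_lf ∕ _one ∕ _pos` serve the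
z-member unchanged and are NOT re-declared) + g3 p608030 (`h3_∕hR_∕hε3_∕hε2_of_ccmShape`, `A0OfThm1CC1_le_one_div_sixteen`).

WHY THIS FILE.  DEF-1's Z family threads the two open fluctuation letters `(Efl, logz)` (FLAG №9) through the makers; the tree's witnesses are its `(0, 0)` members by `rfl`
and the K1 door re-keys to `theta13OfThm1CCMWZ … Efl logz`.  LOCATED-cR persists there verbatim (`theta13OfThm1CCMWZ_cR = 1`: the BorelB ∕ bg road is `2 ≤ cR`-vacuous at the
z-witness, dag-n11-w1 g5 I.39680).  This file is the token-pass of g4's member views and letters to the cR-lettered z-MEMBER `θ₁₃ᶻ(n_c, ε₂₉; Efl, logz)`, `c` a letter: at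
`c ≥ 2` the guard-free bg road's `2 ≤ cR` binder is MET at the z-family exactly as g4∕g5 met it at the W family.  Proofs = p619867's VERBATIM under the token pass
«`theta13LiveOfNumerics F N n_c … Zt ↦ theta13LiveOfNumericsZ F N n_c … Zt Efl logz`, `theta13OfThm1CCMW … a₁ ↦ theta13OfThm1CCMWZ … a₁ Efl logz`» (the member's
`ν ∕ s2 ∕ γ ∕ τ9 ∕ ζ ∕ Rz ∕ Zt` are `(Efl, logz)`-blind, Z1 faces).

WHAT THIS FILE PROVES (9 theorems, 0 `def`, 0 `sorry`; standard axioms).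
§1 ★ `theta13LiveOfNumericsZ_ccmwCRZ_one` · §1b c-BLIND rows at Z (`rfl`): `betaOfRecord₁₃_ccmwCRZ` · `gOfRecord₁₃_ccmwCRZ` · `partCompat₁₃_ccmwCRZ_iff` · `ν_τ9_ccmwCRZ` ·
`s2_cR_ccmwCRZ_and_witness` · §2 at any H-extension: `two_le_cR_of_ccmwCRZH` · `nesting_of_ccmwCRZH` · ★★ `numericRows_of_ccmwCRZH`.

HONEST FRAMING ∕ A6.  Helper lane, count-neutral token-pass of LANDED kernel bookkeeping of this seat's lineage (structure-update `rfl`s, elementary arithmetic); nothing of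
Bałaban asserted; NO value of `E_k ∕ log z_k` pinned or read (`Efl`, `logz` stay letters); NOT a claim that the z-member is K1⁹'s witness; FLAG №9 NOT closed by this; NOT a
re-pin (no `def`).  N11 NOT discharged; K0⁷ ∕ K1⁹ NOT closed, no stub touched; counts unmoved (typed 28∕28 · discharged 5∕27 · A 5∕28).  One finite `𝕋⁴_{L^K}` programme at fixed
`ε = L^{−K}`; `route-QuantumFields-BalabanUVNodes` closes ONLY the CONDITIONAL finite-𝕋⁴ rung `BalabanLadder.UV` — NOT ℝ⁴, NOT OS, NOT the Yang–Mills mass gap (Clay).  No `sorry`,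
no `axiom`, no `def`, no `instance`, no `notation`.
Sources (SHAPE only): [III] (2.4)–(2.8) pp.255–256, (2.10) p.256, (2.13) pp.256–257, (2.16)–(2.17) p.257, (2.28) p.259, (1.15) p.249; [I] Thm 1 p.259, (0.20) p.256, (1.20)–(1.22)
p.264; [15] Thm 1 (7)–(10) pp.278–279; [B7] Prop. 2 p.26; [IV] (0.3) p.176.
-/

noncomputable section

open MeasureTheory
open scoped BigOperators ENNReal NNReal Matrix.Norms.L2Operator

namespace Summit.QuantumFields.YangMills.Theorems.BalabanUVNodesN11SupplyChainAtCRLetteredNumericsZ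

open Literature.MathematicalPhysics.QuantumFieldTheory.Balaban1983to89 T4Continuum T4NestedCovariance Node00 Node00.Tk DagBinding
open B15DeterminingSets B8Eq17ClassAkV1 B14.Eq218Concrete B10Eq42TorusConstraint
open B14.Eq213MaximalDomains (side)
open BalabanUVNodesN11NoExpansionNumerics (hε_of_window)
open BalabanUVNodesN11NoExpansionNumericsAtThm1CCMW

/-! ## §1  At `c := 1` the z-member IS the z-witness -/

section One

/-- **★ AT `c := 1` AND K0b's RESIDUALS OF RECORD THE z-MEMBER IS DEF-1's z-WITNESS `θ₁₅ᶜᶜᴹᵂᶻ(j; γ; Efl, logz) = theta13OfThm1CCMWZ F N j γ … Efl logz`** — BY `rfl`.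
[cite: Balaban1989LargeFieldI, (0.3) p.176; Balaban1988Convergent, (2.10) p.256 (bookkeeping)] -/
theorem theta13LiveOfNumericsZ_ccmwCRZ_one (F : T4Family) (N : ℕ) [NeZero N] (j : ℕ) (γ ε₀ ε₂₉ B₃ B₃' a₀ a₁ : ℝ) (Efl logz : B12.RunParams → ℕ → ℝ) :
    theta13LiveOfNumericsZ F N ({ stage12NumericsOfThm1CCMW F.L j γ ε₀ B₃ B₃' a₀ a₁ with s2 := { sect2NumericsOfThm1C F.L with cR := 1 } } : Stage12Numerics) ε₂₉
        (zeta316OfRecord F N (stage12NumericsOfThm1CCMW F.L j γ ε₀ B₃ B₃' a₀ a₁).ν (stage12NumericsOfThm1CCMW F.L j γ ε₀ B₃ B₃' a₀ a₁).τ9.M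
          (stage12NumericsOfThm1CCMW F.L j γ ε₀ B₃ B₃' a₀ a₁).A₁)
        (RzOfRecord F N) (ZtOfRecord F N) Efl logz =
      theta13OfThm1CCMWZ F N j γ ε₀ ε₂₉ B₃ B₃' a₀ a₁ Efl logz := rfl

end One

/-! ## §1b  ★ THE c-BLIND ROWS (`rfl`): at the record pins the β OF RECORD, the GENERATED COUPLINGS, the RUN GUARD and K0's SOLVABILITY ROW of the member ARE those of
DEF-1's z-witness `θ₁₅ᶜᶜᴹᵂᶻ(j; γ; Efl, logz)` — so K0⁷'s sign-free windowed β-box (`hbox ∕ hbox′` of the door), the window, `PartCompat₁₃` and the per-cube [15]-solvability row do NOT read `c` -/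

section Blind

variable (F : T4Family) (N : ℕ) [NeZero N] (j : ℕ) (γ c ε₀ ε₂₉ B₃ B₃' a₀ a₁ : ℝ) (Efl logz : B12.RunParams → ℕ → ℝ)

/-- **★ THE β OF RECORD IS `c`-BLIND** (`rfl`): at K0b's residual pins the member's `betaOfRecord₁₃` IS `betaOfRecord₁₃ F N θ₁₅ᶜᶜᴹᵂᶻ(j; γ; Efl, logz)` — hence the (sign-free, windowed)
β-box hypotheses of the z-door (`BetaLowerH ∕ BetaUpperH … (betaOfRecord₁₃ F N θ₁₅ᶜᶜᴹᵂᶻ)`, n11-w5 A2ʷ-Z §5) are the SAME hypotheses at the z-member.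
[cite: Balaban1987RG1, (1.20)–(1.22) p.264; Balaban1988Convergent, (2.6)–(2.8) pp.255–256 (bookkeeping)] -/
theorem betaOfRecord₁₃_ccmwCRZ :
    betaOfRecord₁₃ F N (theta13LiveOfNumericsZ F N
        ({ stage12NumericsOfThm1CCMW F.L j γ ε₀ B₃ B₃' a₀ a₁ with s2 := { sect2NumericsOfThm1C F.L with cR := c } } : Stage12Numerics) ε₂₉
        (zeta316OfRecord F N (stage12NumericsOfThm1CCMW F.L j γ ε₀ B₃ B₃' a₀ a₁).ν (stage12NumericsOfThm1CCMW F.L j γ ε₀ B₃ B₃' a₀ a₁).τ9.M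
          (stage12NumericsOfThm1CCMW F.L j γ ε₀ B₃ B₃' a₀ a₁).A₁) (RzOfRecord F N) (ZtOfRecord F N) Efl logz) =
      betaOfRecord₁₃ F N (theta13OfThm1CCMWZ F N j γ ε₀ ε₂₉ B₃ B₃' a₀ a₁ Efl logz) := rfl

/-- **★ THE GENERATED COUPLINGS ARE `c`-BLIND** (`rfl`): `gOfRecord₁₃` of the z-member IS `gOfRecord₁₃ F N θ₁₅ᶜᶜᴹᵂᶻ(j; γ; Efl, logz)` on every run — so the window letter
`Step.InInterval γ …` and every numeric row read the same history. [cite: Balaban1987RG1, (0.20) p.256, §1 p.264 (bookkeeping)] -/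
theorem gOfRecord₁₃_ccmwCRZ (p : B12.RunParams) :
    gOfRecord₁₃ F N (theta13LiveOfNumericsZ F N
        ({ stage12NumericsOfThm1CCMW F.L j γ ε₀ B₃ B₃' a₀ a₁ with s2 := { sect2NumericsOfThm1C F.L with cR := c } } : Stage12Numerics) ε₂₉
        (zeta316OfRecord F N (stage12NumericsOfThm1CCMW F.L j γ ε₀ B₃ B₃' a₀ a₁).ν (stage12NumericsOfThm1CCMW F.L j γ ε₀ B₃ B₃' a₀ a₁).τ9.M
          (stage12NumericsOfThm1CCMW F.L j γ ε₀ B₃ B₃' a₀ a₁).A₁) (RzOfRecord F N) (ZtOfRecord F N) Efl logz) p =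
      gOfRecord₁₃ F N (theta13OfThm1CCMWZ F N j γ ε₀ ε₂₉ B₃ B₃' a₀ a₁ Efl logz) p := rfl

/-- **★ THE RUN GUARD IS `c`-BLIND** (`Iff.rfl`): `PartCompat₁₃` of the z-member at `(p, n)` IS `PartCompat₁₃ F N θ₁₅ᶜᶜᴹᵂᶻ(j; γ; Efl, logz) p n`. [cite: Balaban1988Convergent, (2.1) p.254, p.257 («all partitions are compatible») (bookkeeping)] -/
theorem partCompat₁₃_ccmwCRZ_iff (p : B12.RunParams) (n : ℕ) :
    PartCompat₁₃ F N (theta13LiveOfNumericsZ F N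
        ({ stage12NumericsOfThm1CCMW F.L j γ ε₀ B₃ B₃' a₀ a₁ with s2 := { sect2NumericsOfThm1C F.L with cR := c } } : Stage12Numerics) ε₂₉
        (zeta316OfRecord F N (stage12NumericsOfThm1CCMW F.L j γ ε₀ B₃ B₃' a₀ a₁).ν (stage12NumericsOfThm1CCMW F.L j γ ε₀ B₃ B₃' a₀ a₁).τ9.M
          (stage12NumericsOfThm1CCMW F.L j γ ε₀ B₃ B₃' a₀ a₁).A₁) (RzOfRecord F N) (ZtOfRecord F N) Efl logz) p n ↔
      PartCompat₁₃ F N (theta13OfThm1CCMWZ F N j γ ε₀ ε₂₉ B₃ B₃' a₀ a₁ Efl logz) p n := Iff.rfl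

/-- **★ THE STAGE-7 DICTIONARY AND THE TOWER NUMERICS OF THE z-MEMBER's STAGE-13 PART ARE THOSE OF `θ₁₅ᶜᶜᴹᵂᶻ(j; γ; Efl, logz)`** (`rfl`) — with `gOfRecord₁₃_ccmwCRZ` this makes
K0's per-cube [15]-solvability row `hsolv` (which reads `ν`, `τ9.M` and the generated couplings only) LITERALLY the row at the z-witness. [cite: Balaban1985Variational, Thm 1 (7)–(8) pp.278–279; Balaban1988Convergent, (2.16)–(2.17) p.257 (bookkeeping)] -/
theorem ν_τ9_ccmwCRZ :
    (theta13LiveOfNumericsZ F N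
        ({ stage12NumericsOfThm1CCMW F.L j γ ε₀ B₃ B₃' a₀ a₁ with s2 := { sect2NumericsOfThm1C F.L with cR := c } } : Stage12Numerics) ε₂₉
        (zeta316OfRecord F N (stage12NumericsOfThm1CCMW F.L j γ ε₀ B₃ B₃' a₀ a₁).ν (stage12NumericsOfThm1CCMW F.L j γ ε₀ B₃ B₃' a₀ a₁).τ9.M
          (stage12NumericsOfThm1CCMW F.L j γ ε₀ B₃ B₃' a₀ a₁).A₁) (RzOfRecord F N) (ZtOfRecord F N) Efl logz).ν = (theta13OfThm1CCMWZ F N j γ ε₀ ε₂₉ B₃ B₃' a₀ a₁ Efl logz).ν ∧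
    (theta13LiveOfNumericsZ F N
        ({ stage12NumericsOfThm1CCMW F.L j γ ε₀ B₃ B₃' a₀ a₁ with s2 := { sect2NumericsOfThm1C F.L with cR := c } } : Stage12Numerics) ε₂₉
        (zeta316OfRecord F N (stage12NumericsOfThm1CCMW F.L j γ ε₀ B₃ B₃' a₀ a₁).ν (stage12NumericsOfThm1CCMW F.L j γ ε₀ B₃ B₃' a₀ a₁).τ9.M
          (stage12NumericsOfThm1CCMW F.L j γ ε₀ B₃ B₃' a₀ a₁).A₁) (RzOfRecord F N) (ZtOfRecord F N) Efl logz).τ9 = (theta13OfThm1CCMWZ F N j γ ε₀ ε₂₉ B₃ B₃' a₀ a₁ Efl logz).τ9 :=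
  ⟨rfl, rfl⟩

/-- **★ THE ONE STAGE-13 FIELD THAT READS `c`**: the z-member's `s2.cR` is `c` while `θ₁₅ᶜᶜᴹᵂᶻ`'s is `1` (both `rfl`) — LOCATED-cR persists verbatim at the z-family. [cite: Balaban1988Convergent, (2.10) p.256 (bookkeeping)] -/
theorem s2_cR_ccmwCRZ_and_witness :
    (theta13LiveOfNumericsZ F N
        ({ stage12NumericsOfThm1CCMW F.L j γ ε₀ B₃ B₃' a₀ a₁ with s2 := { sect2NumericsOfThm1C F.L with cR := c } } : Stage12Numerics) ε₂₉
        (zeta316OfRecord F N (stage12NumericsOfThm1CCMW F.L j γ ε₀ B₃ B₃' a₀ a₁).ν (stage12NumericsOfThm1CCMW F.L j γ ε₀ B₃ B₃' a₀ a₁).τ9.M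
          (stage12NumericsOfThm1CCMW F.L j γ ε₀ B₃ B₃' a₀ a₁).A₁) (RzOfRecord F N) (ZtOfRecord F N) Efl logz).s2.cR = c ∧
    (theta13OfThm1CCMWZ F N j γ ε₀ ε₂₉ B₃ B₃' a₀ a₁ Efl logz).s2.cR = 1 := ⟨rfl, rfl⟩

end Blind

/-! ## §2  The θ-level letters at any H-extension of the z-member `θ₁₃ᶻ(n_c, ε₂₉; Efl, logz)` -/

section Letters

variable {F : T4Family} {N : ℕ} [NeZero N]
variable {j : ℕ} {γ c ε₀ ε₂₉ B₃ B₃' a₀ a₁ : ℝ}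
  {ζ : ZetaOfRecord F N (stage12NumericsOfThm1CCMW F.L j γ ε₀ B₃ B₃' a₀ a₁).ν (stage12NumericsOfThm1CCMW F.L j γ ε₀ B₃ B₃' a₀ a₁).τ9.M}
  {Rz : (K : ℕ) → Sect2.Residual (F.P K) (MatA N)} {Zt : (K : ℕ) → TkResidualW F N (FluctV N) K} {Efl logz : B12.RunParams → ℕ → ℝ}
  {θ : Stage13HParams F N}

/-- **`2 ≤ cR` AT THE z-MEMBER** (⟸ `2 ≤ c`): the one letter of the road that fails at every witness of record (W or Z) holds here. [cite: Balaban1988Convergent, (2.10) p.256; Balaban1985Averaging, Prop. 2 p.26 (bookkeeping)] -/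
theorem two_le_cR_of_ccmwCRZH
    (hθ : θ.toStage13Params = theta13LiveOfNumericsZ F N
      ({ stage12NumericsOfThm1CCMW F.L j γ ε₀ B₃ B₃' a₀ a₁ with s2 := { sect2NumericsOfThm1C F.L with cR := c } } : Stage12Numerics) ε₂₉ ζ Rz Zt Efl logz)
    (hc : 2 ≤ c) : 2 ≤ θ.s2.cR := by
  obtain ⟨⟨θ₁, Zr⟩, Zh, Phih⟩ := θ
  obtain rfl : θ₁ = _ := hθ
  exact hc

/-- **THE NESTING `L·M₂ ∣ M` AT THE z-MEMBER** (`M₂ = 1`, `M = L^j`, `1 ≤ j`). [cite: Balaban1988Convergent, (2.1) p.254, (2.17) p.257 (bookkeeping)] -/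
theorem nesting_of_ccmwCRZH
    (hθ : θ.toStage13Params = theta13LiveOfNumericsZ F N
      ({ stage12NumericsOfThm1CCMW F.L j γ ε₀ B₃ B₃' a₀ a₁ with s2 := { sect2NumericsOfThm1C F.L with cR := c } } : Stage12Numerics) ε₂₉ ζ Rz Zt Efl logz)
    (hj : 1 ≤ j) (p : B12.RunParams) : (F.P p.K).L * θ.ν.M₂ ∣ θ.τ9.M := by
  obtain ⟨⟨θ₁, Zr⟩, Zh, Phih⟩ := θ
  obtain rfl : θ₁ = _ := hθ
  show F.L * 1 ∣ F.L ^ j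
  rw [mul_one]
  exact dvd_pow_self _ (by omega)

/-- **★★ THE FIVE NUMERIC ROWS OF THE NO-EXPANSION 𝐓-STEP AT THE z-MEMBER, ON EVERY RUN IN THE WINDOW `]0, γ]`, EVERY LEVEL, FROM THE FOUR γ-CONDITIONS** — p608030 §2 VERBATIM (token-pass of p619867 §2)
(the Stage-7 part is `numerics7OfThm1CCM`, `c`-blind: `M₁ = L^j`, `M₂ = r = p₀ = 1`, `0 < A₀ᶜᶜ¹ ≤ 1∕16`).
[cite: Balaban1988Convergent, (2.4)–(2.5) p.255, (2.13) pp.256–257, (2.17) p.257; Balaban1985Averaging, Prop. 2 p.26; Balaban1987RG1, Thm 1 p.259; Balaban1985Variational, Thm 1 (7)–(10) p.279 (bookkeeping)] -/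
theorem numericRows_of_ccmwCRZH
    (hθ : θ.toStage13Params = theta13LiveOfNumericsZ F N
      ({ stage12NumericsOfThm1CCMW F.L j γ ε₀ B₃ B₃' a₀ a₁ with s2 := { sect2NumericsOfThm1C F.L with cR := c } } : Stage12Numerics) ε₂₉ ζ Rz Zt Efl logz)
    (hB : 0 ≤ B₃) (hB' : 0 ≤ B₃') (ha₀ : 0 < a₀) (ha₁ : 0 < a₁) (hγ0 : 0 < γ) (hγe : γ ≤ Real.exp (-1))
    (h3γ : 3 * (F.L : ℝ) ^ j ≤ F.L * Real.log (γ ^ 2)⁻¹) (hRγ : ((8 * F.L + 3 : ℕ) : ℝ) ≤ F.L * Real.log (γ ^ 2)⁻¹)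
    (hε3γ : 36608 * (γ * Real.log (γ ^ 2)⁻¹) ≤ 16 / 3) (hε2γ : γ * Real.log (γ ^ 2)⁻¹ ≤ 16 * ExpMeanLog.deltaSU (Fin N) / ((8 * F.L : ℕ) : ℝ) ^ 2)
    (p : B12.RunParams) {k : ℕ} (hw : Step.InInterval γ k (gOfRecord₁₃ F N θ.toStage13Params p)) :
      (∀ i, 1 ≤ i → i ≤ k →
          3 * side (F.P p.K).L θ.ν.M₁ i ≤ cubeSide (F.P p.K).L θ.ν.M₂ (RkOfRecord (F.P p.K).L θ.ν.r (gOfRecord₁₃ F N θ.toStage13Params p i)) i) ∧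
      (∀ i, 1 ≤ i → i ≤ k → (F.P p.K).L ^ i + (((F.P p.K).d + 4) * (F.P p.K).L + 2) * (∑ l ∈ Finset.range i, (F.P p.K).L ^ l) + 2 ≤
          cubeSide (F.P p.K).L θ.ν.M₂ (RkOfRecord (F.P p.K).L θ.ν.r (gOfRecord₁₃ F N θ.toStage13Params p i)) i) ∧
      (∀ i, 1 ≤ i → i ≤ k → 0 < epsOfRecord θ.ν (gOfRecord₁₃ F N θ.toStage13Params p) i) ∧
      (∀ i, 1 ≤ i → i ≤ k → (143 * (((((F.P p.K).d + 4 : ℕ) : ℝ)) ^ 2 / 4) ^ 2) * epsOfRecord θ.ν (gOfRecord₁₃ F N θ.toStage13Params p) i ≤ 1 / 3) ∧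
      (∀ i, 1 ≤ i → i ≤ k → 2 * epsOfRecord θ.ν (gOfRecord₁₃ F N θ.toStage13Params p) i ≤
          2 * ExpMeanLog.deltaSU (Fin N) / ((((F.P p.K).d + 4) * (F.P p.K).L : ℕ) : ℝ) ^ 2) := by
  obtain ⟨⟨θ₁, Zr⟩, Zh, Phih⟩ := θ
  obtain rfl : θ₁ = _ := hθ
  set θ : Stage13HParams F N := ⟨⟨theta13LiveOfNumericsZ F N
      ({ stage12NumericsOfThm1CCMW F.L j γ ε₀ B₃ B₃' a₀ a₁ with s2 := { sect2NumericsOfThm1C F.L with cR := c } } : Stage12Numerics) ε₂₉ ζ Rz Zt Efl logz, Zr⟩, Zh, Phih⟩ with hθdef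
  have hγ1 : γ ≤ 1 := hγe.trans (Real.exp_lt_one_iff.mpr (by norm_num : (-1 : ℝ) < 0)).le
  have hA : 0 < θ.ν.A₀ := A0OfThm1CC1_pos hB hB' ha₀ ha₁
  have hA16 : θ.ν.A₀ ≤ 1 / 16 := A0OfThm1CC1_le_one_div_sixteen hB hB' ha₀.le ha₁.le
  have hw' : Step.InInterval θ.γ k (gOfRecord₁₃ F N θ.toStage13Params p) := hw
  refine ⟨h3_of_ccmShape θ p rfl rfl rfl hγ1 h3γ hw', hR_of_ccmShape θ p rfl rfl hγ1 ?_ hw', hε_of_window θ p hA (hγe.trans_lt (Real.exp_lt_one_iff.mpr (by norm_num))) hw',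
    hε3_of_ccmShape θ p rfl hA hA16 hγ0 hγe hε3γ hw', hε2_of_ccmShape θ p rfl hA hA16 hγe ?_ hw'⟩
  · show ((8 * (F.P p.K).L + 3 : ℕ) : ℝ) ≤ (F.P p.K).L * Real.log (γ ^ 2)⁻¹
    rw [T4Family.P_L]; exact hRγ
  · show γ * Real.log (γ ^ 2)⁻¹ ≤ 16 * ExpMeanLog.deltaSU (Fin N) / ((((F.P p.K).d + 4) * (F.P p.K).L : ℕ) : ℝ) ^ 2
    rw [T4Family.P_d, T4Family.P_L]; exact hε2γ

end Letters

end Summit.QuantumFields.YangMills.Theorems.BalabanUVNodesN11SupplyChainAtCRLetteredNumericsZ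

end
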